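import Literature.Geometry.Lorentzian.KerrDeSitterRadialTSCosmoLimitThreeHalves
import Literature.Geometry.Lorentzian.KerrDeSitterRadialTSEventLimitThreeHalves
import Literature.Geometry.Lorentzian.KerrDeSitterRadialTSConstantThreeHalves
import HarnessLib

/-!
# Half-integer spin `|s| = 3/2` on the real axis, VI: the energy identity and the mode-exclusion
# theorem — Casals–Teixeira da Costa's Theorem 3.10, fermionic clause at `s = 3/2`, in its domain of
# validity (`ℭ_{3/2} ≥ 0`)

This file assembles files I–V of the series into the `|s| = 3/2` twin of
`radial_half_real_eq_zero_of_coercive` (`KerrDeSitterFermionicRealAxis.lean`). On subextremal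
Kerr–de Sitter, for REAL `ω` (any, including `ω = 0`) and REAL separation constant `λ`, let `R` be a
classical solution of the spin-`3/2` radial Teukolsky equation on `(r₊, r_c)`, ingoing at `𝓗⁺`
(`R = (r − r₊)^{−3/2 − B(r₊)}f`) and outgoing at `𝓗⁺_c` (`R = (r_c − r)^{B(r_c)}g`). The
Teukolsky–Starobinsky form `W(r; R, R′)` (file II) is constant on `(r₊, r_c)`
(`hasDerivAt_tsFormThreeHalves_of_solution`); its right limit at `r₊` is
`−ℭ_{3/2}·Δ_r′(r₊)/(4β₊² + 1/4)·|f(r₊)|²` (file V, `tendsto_tsFormThreeHalves_rPlus`, with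
`ℭ_{3/2} = tsRadialConstantThreeHalves … (lambdaBar … λ)`, Wu–Yan's `|C_{3/2}|²` at the tree's `λ`,
`tsqTSConst_kds`) and its left limit at `r_c` is
`(4K̃_c² + Δ_r′(r_c)²/4)(4K̃_c² + 9Δ_r′(r_c)²/4)·|g(r_c)|²` (file III). THE ENERGY IDENTITY: the
two are equal. Since `Δ_r′(r₊) > 0` and the `r_c` weight is positive, `ℭ_{3/2} ≥ 0` forces
`g(r_c) = 0`, and `radial_eq_zero_of_cosmoAmplitude_eq_zero` (`KerrDeSitterRadialAmplitude.lean`)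
gives `R ≡ 0`: `radial_threeHalves_real_eq_zero_of_coercive`.
No condition on `ω ≠ 0`, on `m`, on `a`, and no superradiant-window condition. For `ℭ_{3/2} < 0`
the identity fixes the amplitude ratio `|g(r_c)|²/|f(r₊)|²` and proves nothing (and real-frequency
solutions then do occur: cell pub-kds' certified `s = 3/2` zeros all have `ℭ_{3/2} < 0`).
Definitions with bodies + theorems, NO named facts.

Sources: [CasalsTeixeiradacosta2022] Theorem 3.10, second bullet, with its printed proof for
half-integer `s` (p. 17 l. 56: "By the same method [the Teukolsky–Starobinsky identities] …
`u ≡ 0` holds independently of `ω`"); [Costa2019] Proposition 2.21 (the half-integer energy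
identity, coercive exactly when `ℭ_s ≥ 0`); [WuYan2004] Appendix A (A5)–(A6).
-/

noncomputable section

open Complex Set Filter Topology

open scoped ComplexConjugate

namespace Literature.Geometry.Lorentzian.KerrDeSitter

/-! ### Dictionary: the generic objects on Kerr–de Sitter -/

/-- **The generic Teukolsky–Starobinsky constant is Wu–Yan's `|C_{3/2}|²`** at the tree's
separation constant: with `d₀ = a²`, `d₁ = −2M`, `d₂ = 1 − Λa²/3`, `d₄ = −Λ/3`,
`k₀ = Ξ(Re ω·a² − am)`, `k₂ = Ξ Re ω`, `λ̃ = Re λ + (1 − α)/3`, and `ω`, `λ` real,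
`tsqTSConst = Re ℭ_{3/2}(λ̄)`, `λ̄ = lambdaBar a Λ (3/2) ω m λ`.
[cite: WuYan2004, Appendix A, (A6)] -/
theorem tsqTSConst_kds (M a Λ : ℝ) {ω : ℂ} (hω : ω.im = 0) (m : ℝ) {lam : ℂ} (hlam : lam.im = 0) :
    tsqTSConst (a ^ 2) (-(2 * M)) (1 - Λ / 3 * a ^ 2) (-(Λ / 3)) (kdsK0 a Λ ω m) (kdsK2 a Λ ω)
        (kdsEl a Λ lam) =
      (tsRadialConstantThreeHalves M a Λ ω m (lambdaBar a Λ (3 / 2) ω m lam)).re := by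
  have hωr : ω = ((ω.re : ℝ) : ℂ) := Complex.ext (by simp) (by simp [hω])
  have hlamr : lam = ((lam.re : ℝ) : ℂ) := Complex.ext (by simp) (by simp [hlam])
  rw [tsRadialConstantThreeHalves_lambdaBar]
  conv_rhs => rw [hωr, hlamr]
  have h : ((((lam.re : ℝ) : ℂ) ^ 2 + ((4 * a ^ 2 * (Λ / 3) : ℝ) : ℂ)) *
        (((lam.re : ℝ) : ℂ) + 1 - (alpha a Λ : ℂ)) -
      16 * (xi a Λ : ℂ) ^ 2 *
        (((lam.re : ℝ) : ℂ) * ((a : ℂ) * ((ω.re : ℝ) : ℂ)) *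
            ((a : ℂ) * ((ω.re : ℝ) : ℂ) - (m : ℂ)) +
          (alpha a Λ : ℂ) * ((a : ℂ) * ((ω.re : ℝ) : ℂ) - (m : ℂ)) ^ 2 -
          (a : ℂ) ^ 2 * ((ω.re : ℝ) : ℂ) ^ 2) -
      ((4 * M ^ 2 * (Λ / 3) : ℝ) : ℂ)) =
      (((lam.re ^ 2 + 4 * a ^ 2 * (Λ / 3)) * (lam.re + 1 - alpha a Λ) -
        16 * xi a Λ ^ 2 * (lam.re * (a * ω.re) * (a * ω.re - m) + alpha a Λ * (a * ω.re - m) ^ 2 -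
          a ^ 2 * ω.re ^ 2) - 4 * M ^ 2 * (Λ / 3) : ℝ) : ℂ) := by
    push_cast; ring
  rw [h, ofReal_re]
  unfold tsqTSConst kdsK0 kdsK2 kdsEl alpha xi
  ring

/-- The tree's pointwise spin-`3/2` radial equation at real `ω`, `λ` in the generic polynomial form
`Δ²R″ + (5/2)ΔΔ′R′ + N_V R = 0`. [cite: SuzukiTakasugiUmetsu1998, (3.7)] -/
theorem tsq_ode_of_radialThreeHalves {M a Λ : ℝ} {ω : ℂ} {m : ℝ} {lam : ℂ} {R R' R'' : ℝ → ℂ}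
    {r : ℝ} (hω : ω.im = 0) (hlam : lam.im = 0) (hΔ : delta M a Λ r ≠ 0)
    (heq : (delta M a Λ r : ℂ) * R'' r + ((3 / 2 + 1 : ℝ) : ℂ) * (deltaDeriv M a Λ r : ℂ) * R' r +
      radialPotential M a Λ (3 / 2) ω m lam r * R r = 0) :
    (tsqDelta (a ^ 2) (-(2 * M)) (1 - Λ / 3 * a ^ 2) (-(Λ / 3)) r : ℂ) ^ 2 * R'' r +
      5 / 2 * (tsqDelta (a ^ 2) (-(2 * M)) (1 - Λ / 3 * a ^ 2) (-(Λ / 3)) r : ℂ) *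
          (tsqDeltaD (-(2 * M)) (1 - Λ / 3 * a ^ 2) (-(Λ / 3)) r : ℂ) * R' r +
        ((tsqNVre (a ^ 2) (-(2 * M)) (1 - Λ / 3 * a ^ 2) (-(Λ / 3)) (kdsK0 a Λ ω m) (kdsK2 a Λ ω)
              (kdsEl a Λ lam) r : ℂ) +
          I * (tsqNVim (a ^ 2) (-(2 * M)) (1 - Λ / 3 * a ^ 2) (-(Λ / 3)) (kdsK0 a Λ ω m)
              (kdsK2 a Λ ω) r : ℂ)) * R r = 0 := by
  have hV := radialPotential_threeHalves_mul_delta M a Λ hω m hlam hΔ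
  rw [← delta_eq_tsqDelta, ← deltaDeriv_eq_tsqDeltaD, ← hV]
  have h := congrArg (fun z => z * (delta M a Λ r : ℂ)) heq
  simp only [zero_mul] at h
  push_cast at h
  linear_combination h

/-! ### The right limit at `r₊` on Kerr–de Sitter -/

/-- **Right limit of the `s = 3/2` Teukolsky–Starobinsky form at the event horizon of Kerr–de
Sitter.** On subextremal Kerr–de Sitter with `Im ω = Im λ = 0`, let `R` solve the spin-`3/2` radial
equation on `(r₊, r_c)` (pointwise, with derivative witnesses `R′`, `R″`) and be ingoing at `𝓗⁺`:
`R·(r − r₊)^{3/2 + B(r₊)} = f` on `(r₊, r₊ + ε)`, `f` smooth on `(r₊ − ε, r₊ + ε)`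
(`IsIngoingAtEventHorizon`, unpacked). Then
`W(r; R(r), R′(r)) → −Re ℭ_{3/2}(λ̄)·Δ_r′(r₊)/(1/4 + 4β₊²)·|f(r₊)|²` as `r ↓ r₊`,
`β₊ = ΞK(r₊)/Δ_r′(r₊)` (`tendsto_tsqForm_singular` at `p = r₊` with `tsqTSConst_kds`).
[cite: Costa2019, Proposition 2.21; CasalsTeixeiradacosta2022, Definition 3.3] -/
theorem tendsto_tsFormThreeHalves_rPlus {M a Λ : ℝ} {ω : ℂ} {m : ℝ} {lam : ℂ}
    (hsub : IsSubextremal M a Λ) (hω : ω.im = 0) (hlam : lam.im = 0) {R R' R'' : ℝ → ℂ}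
    (hode : ∀ r ∈ Ioo (rPlus M a Λ) (rCosmo M a Λ),
      HasDerivAt R (R' r) r ∧ HasDerivAt R' (R'' r) r ∧
        (delta M a Λ r : ℂ) * R'' r + ((3 / 2 + 1 : ℝ) : ℂ) * (deltaDeriv M a Λ r : ℂ) * R' r +
            radialPotential M a Λ (3 / 2) ω m lam r * R r = 0)
    {ε : ℝ} (hε : 0 < ε) {f : ℝ → ℂ}
    (hf : ContDiffOn ℝ ((⊤ : ℕ∞) : WithTop ℕ∞) f (Ioo (rPlus M a Λ - ε) (rPlus M a Λ + ε)))
    (hRf : ∀ r ∈ Ioo (rPlus M a Λ) (rPlus M a Λ + ε),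
      R r * ((r - rPlus M a Λ : ℝ) : ℂ) ^ ((((3 / 2 : ℝ)) : ℂ) + horizonB M a Λ ω m (rPlus M a Λ)) =
        f r) :
    Tendsto (fun x => tsFormThreeHalves M a Λ ω m lam x (R x) (R' x)) (𝓝[>] rPlus M a Λ)
      (𝓝 (-((tsRadialConstantThreeHalves M a Λ ω m (lambdaBar a Λ (3 / 2) ω m lam)).re *
          deltaDeriv M a Λ (rPlus M a Λ)) /
        (1 / 4 + 4 * (xi a Λ * (radialK a ω m (rPlus M a Λ)).re /
          deltaDeriv M a Λ (rPlus M a Λ)) ^ 2) * normSq (f (rPlus M a Λ)))) := by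
  have hd1 := deltaDeriv_rPlus_pos hsub
  obtain ⟨-, -, -, h12, hΔ1, -, -, hΔpos, -⟩ := hsub
  obtain ⟨Kp, hKp⟩ : ∃ Kp : ℝ, Kp = (radialK a ω m (rPlus M a Λ)).re := ⟨_, rfl⟩
  have hKreal : radialK a ω m (rPlus M a Λ) = (Kp : ℂ) := by
    rw [hKp]; exact Complex.ext (by simp) (by simp [im_radialK_of_real a hω m (rPlus M a Λ)])
  have hwK : horizonB M a Λ ω m (rPlus M a Λ) =
      I * ((xi a Λ * Kp / deltaDeriv M a Λ (rPlus M a Λ) : ℝ) : ℂ) := by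
    simp only [horizonB]
    rw [hKreal]
    push_cast
    field_simp
  have hΔp : tsqDelta (a ^ 2) (-(2 * M)) (1 - Λ / 3 * a ^ 2) (-(Λ / 3)) (rPlus M a Λ) = 0 := by
    rw [← delta_eq_tsqDelta]; exact hΔ1
  have hDt : tsqDeltaD (-(2 * M)) (1 - Λ / 3 * a ^ 2) (-(Λ / 3)) (rPlus M a Λ) =
      deltaDeriv M a Λ (rPlus M a Λ) := (deltaDeriv_eq_tsqDeltaD M a Λ _).symm
  have hD : tsqDeltaD (-(2 * M)) (1 - Λ / 3 * a ^ 2) (-(Λ / 3)) (rPlus M a Λ) ≠ 0 := by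
    rw [hDt]; exact hd1.ne'
  have hKt : tsqK (kdsK0 a Λ ω m) (kdsK2 a Λ ω) (rPlus M a Λ) = xi a Λ * Kp := by
    rw [hKp]
    simp only [tsqK, kdsK0, kdsK2, radialK, sub_re, mul_re, ofReal_re, ofReal_im, mul_zero,
      sub_zero]
    ring
  have hβ : xi a Λ * Kp / deltaDeriv M a Λ (rPlus M a Λ) *
      tsqDeltaD (-(2 * M)) (1 - Λ / 3 * a ^ 2) (-(Λ / 3)) (rPlus M a Λ) =
      tsqK (kdsK0 a Λ ω m) (kdsK2 a Λ ω) (rPlus M a Λ) := by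
    rw [hDt, hKt, div_mul_cancel₀ _ hd1.ne']
  have hΔJ : ∀ x ∈ Ioo (rPlus M a Λ) (rCosmo M a Λ),
      tsqDelta (a ^ 2) (-(2 * M)) (1 - Λ / 3 * a ^ 2) (-(Λ / 3)) x ≠ 0 := by
    intro x hx; rw [← delta_eq_tsqDelta]; exact (hΔpos x hx).ne'
  have hode' : ∀ x ∈ Ioo (rPlus M a Λ) (rCosmo M a Λ), HasDerivAt R (R' x) x ∧
      HasDerivAt R' (R'' x) x ∧
      (tsqDelta (a ^ 2) (-(2 * M)) (1 - Λ / 3 * a ^ 2) (-(Λ / 3)) x : ℂ) ^ 2 * R'' x +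
        5 / 2 * (tsqDelta (a ^ 2) (-(2 * M)) (1 - Λ / 3 * a ^ 2) (-(Λ / 3)) x : ℂ) *
          (tsqDeltaD (-(2 * M)) (1 - Λ / 3 * a ^ 2) (-(Λ / 3)) x : ℂ) * R' x +
        ((tsqNVre (a ^ 2) (-(2 * M)) (1 - Λ / 3 * a ^ 2) (-(Λ / 3)) (kdsK0 a Λ ω m) (kdsK2 a Λ ω)
              (kdsEl a Λ lam) x : ℂ) +
          I * (tsqNVim (a ^ 2) (-(2 * M)) (1 - Λ / 3 * a ^ 2) (-(Λ / 3)) (kdsK0 a Λ ω m)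
              (kdsK2 a Λ ω) x : ℂ)) * R x = 0 := by
    intro x hx
    obtain ⟨h1, h2, heq⟩ := hode x hx
    exact ⟨h1, h2, tsq_ode_of_radialThreeHalves hω hlam (hΔpos x hx).ne' heq⟩
  have hRf' : ∀ r ∈ Ioo (rPlus M a Λ) (rPlus M a Λ + ε), R r * ((r - rPlus M a Λ : ℝ) : ℂ) ^
      ((((3 / 2 : ℝ)) : ℂ) + I * ((xi a Λ * Kp / deltaDeriv M a Λ (rPlus M a Λ) : ℝ) : ℂ)) =
        f r := by
    intro r hr
    rw [← hwK]
    exact hRf r hr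
  have h := tendsto_tsqForm_singular (el := kdsEl a Λ lam) hΔp hD hβ h12 hΔJ hode' hε hf hRf'
  rw [tsqTSConst_kds M a Λ hω m hlam, hDt, hKp] at h
  exact h

/-! ### The theorem -/

/-- **CTdC Theorem 3.10, fermionic real-axis clause at `s = +3/2`, in its domain of validity
(`ℭ_{3/2}(λ̄) ≥ 0`) — PROVED.** On subextremal Kerr–de Sitter let `R` be a classical solution of the
spin-`3/2` radial Teukolsky equation on `(r₊, r_c)` with REAL frequency `ω` (any, including `ω = 0`)
and REAL separation constant `λ` with `Re ℭ_{3/2}(λ̄) ≥ 0`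
(`ℭ_{3/2} = tsRadialConstantThreeHalves`, Wu–Yan's `|C_{3/2}|²`, at
`λ̄ = lambdaBar a Λ (3/2) ω m λ`),
ingoing at `𝓗⁺` and outgoing at `𝓗⁺_c` (generic exponents). Then `R ≡ 0` on `(r₊, r_c)`.
Mechanism (the `s = 3/2` energy identity): the Teukolsky–Starobinsky form `W(r; R, R′)` is constant
(`hasDerivAt_tsFormThreeHalves_of_solution`); its limits are
`−Re ℭ_{3/2}·Δ_r′(r₊)/(1/4 + 4β₊²)·|f(r₊)|² ≤ 0` at `r₊` (`tendsto_tsFormThreeHalves_rPlus`) and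
`c_c·|g(r_c)|² ≥ 0`, `c_c > 0`, at `r_c` (`tendsto_tsFormThreeHalves_rCosmo`); the Cauchy mean value
theorem with endpoint limits equates them, so `g(r_c) = 0` and
`radial_eq_zero_of_cosmoAmplitude_eq_zero` concludes. No window / rotation / `m` condition.
[cite: CasalsTeixeiradacosta2022, Theorem 3.10 (second bullet, |s| = 3/2) with Costa2019
Proposition 2.21] -/
theorem radial_threeHalves_real_eq_zero_of_coercive {M a Λ : ℝ} {ω : ℂ} {m : ℝ} {lam : ℂ}
    (hsub : IsSubextremal M a Λ) (hω : ω.im = 0) (hlam : lam.im = 0)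
    (hcoer : 0 ≤ (tsRadialConstantThreeHalves M a Λ ω m (lambdaBar a Λ (3 / 2) ω m lam)).re)
    {R : ℝ → ℂ} (hR : IsRadialTeukolskySolution M a Λ (3 / 2) ω m lam R)
    (hin : IsIngoingAtEventHorizon M a Λ (3 / 2) ω m R)
    (hout : IsOutgoingAtCosmoHorizon M a Λ ω m R) :
    ∀ r ∈ Ioo (rPlus M a Λ) (rCosmo M a Λ), R r = 0 := by
  have hd1 := deltaDeriv_rPlus_pos hsub
  have hcc := tsCosmoWeightThreeHalves_pos hsub ω m
  have hsub' := hsub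
  obtain ⟨-, -, -, h12, -, -, -, -, -⟩ := hsub
  have hωim : 0 ≤ ω.im := le_of_eq hω.symm
  obtain ⟨R', R'', hode⟩ := id hR
  obtain ⟨ε₁, hε₁, f, hf, hRf⟩ := hin
  obtain ⟨ε₂, hε₂, g, hg, hRg⟩ := hout
  have hR' : ∀ r ∈ Ioo (rPlus M a Λ) (rCosmo M a Λ), HasDerivAt R (R' r) r := fun r hr =>
    (hode r hr).1
  -- the conserved form and its two horizon limits
  have hQd := hasDerivAt_tsFormThreeHalves_of_solution hsub' hω hlam hode
  have hRf' : ∀ r ∈ Ioo (rPlus M a Λ) (rPlus M a Λ + ε₁),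
      R r * ((r - rPlus M a Λ : ℝ) : ℂ) ^ ((((3 / 2 : ℝ)) : ℂ) + horizonB M a Λ ω m (rPlus M a Λ)) =
        f r := hRf
  have hlim₁ := tendsto_tsFormThreeHalves_rPlus hsub' hω hlam hode hε₁ hf hRf'
  have hlim₂ := tendsto_tsFormThreeHalves_rCosmo lam hsub' hω hR' hε₂ hg hRg
  -- conservation: the two limits agree
  have hLeq : -((tsRadialConstantThreeHalves M a Λ ω m (lambdaBar a Λ (3 / 2) ω m lam)).re *
        deltaDeriv M a Λ (rPlus M a Λ)) /
        (1 / 4 + 4 * (xi a Λ * (radialK a ω m (rPlus M a Λ)).re /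
          deltaDeriv M a Λ (rPlus M a Λ)) ^ 2) * normSq (f (rPlus M a Λ)) =
      tsCosmoWeightThreeHalves M a Λ ω m * normSq (g (rCosmo M a Λ)) := by
    obtain ⟨c, -, hc⟩ := exists_ratio_hasDerivAt_eq_ratio_slope'
      (f := fun y => tsFormThreeHalves M a Λ ω m lam y (R y) (R' y))
      (f' := fun _ => (0 : ℝ)) h12 (g := id) (g' := fun _ => (1 : ℝ))
      (lfa := -((tsRadialConstantThreeHalves M a Λ ω m (lambdaBar a Λ (3 / 2) ω m lam)).re *
          deltaDeriv M a Λ (rPlus M a Λ)) /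
          (1 / 4 + 4 * (xi a Λ * (radialK a ω m (rPlus M a Λ)).re /
            deltaDeriv M a Λ (rPlus M a Λ)) ^ 2) * normSq (f (rPlus M a Λ)))
      (lga := rPlus M a Λ) (lfb := tsCosmoWeightThreeHalves M a Λ ω m * normSq (g (rCosmo M a Λ)))
      (lgb := rCosmo M a Λ)
      (fun x hx => hQd x hx) (fun x _ => hasDerivAt_id x) hlim₁
      ((continuous_id.tendsto _).mono_left nhdsWithin_le_nhds) hlim₂
      ((continuous_id.tendsto _).mono_left nhdsWithin_le_nhds)
    simp only [mul_zero, mul_one] at hc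
    linarith
  -- signs: the `r₊` value is `≤ 0`, the `r_c` value is `≥ 0` with a positive weight
  have hneg : -((tsRadialConstantThreeHalves M a Λ ω m (lambdaBar a Λ (3 / 2) ω m lam)).re *
        deltaDeriv M a Λ (rPlus M a Λ)) /
        (1 / 4 + 4 * (xi a Λ * (radialK a ω m (rPlus M a Λ)).re /
          deltaDeriv M a Λ (rPlus M a Λ)) ^ 2) * normSq (f (rPlus M a Λ)) ≤ 0 := by
    have h1 : 0 ≤ (tsRadialConstantThreeHalves M a Λ ω m (lambdaBar a Λ (3 / 2) ω m lam)).re *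
        deltaDeriv M a Λ (rPlus M a Λ) := mul_nonneg hcoer hd1.le
    have h2 : 0 < 1 / 4 + 4 * (xi a Λ * (radialK a ω m (rPlus M a Λ)).re /
        deltaDeriv M a Λ (rPlus M a Λ)) ^ 2 := by positivity
    have h3 : -((tsRadialConstantThreeHalves M a Λ ω m (lambdaBar a Λ (3 / 2) ω m lam)).re *
        deltaDeriv M a Λ (rPlus M a Λ)) /
        (1 / 4 + 4 * (xi a Λ * (radialK a ω m (rPlus M a Λ)).re /
          deltaDeriv M a Λ (rPlus M a Λ)) ^ 2) ≤ 0 :=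
      div_nonpos_of_nonpos_of_nonneg (by linarith) h2.le
    exact mul_nonpos_of_nonpos_of_nonneg h3 (normSq_nonneg _)
  have hg0 : g (rCosmo M a Λ) = 0 := by
    have hY : 0 ≤ normSq (g (rCosmo M a Λ)) := normSq_nonneg _
    have hY0 : normSq (g (rCosmo M a Λ)) = 0 := by
      by_contra hN
      have hpos : 0 < normSq (g (rCosmo M a Λ)) := lt_of_le_of_ne hY (Ne.symm hN)
      have := mul_pos hcc hpos
      linarith
    exact Complex.normSq_eq_zero.1 hY0
  exact radial_eq_zero_of_cosmoAmplitude_eq_zero hsub' hωim (by norm_num) hR hε₂ hg hRg hg0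

/-! ### Packaging with CTdC's binder `Im λ̄ = 0` and a coercivity clause -/

/-- **The Teukolsky–Starobinsky coercivity clause for the fermionic real-axis case at `s = +3/2`**:
`s = 3/2` and `Re ℭ_{3/2}(λ̄) ≥ 0`, `λ̄ = lambdaBar a Λ (3/2) ω m λ`,
`ℭ_{3/2} = tsRadialConstantThreeHalves` (Wu–Yan's `|C_{3/2}|²`) — the condition under which the
`s = 3/2` energy identity is coercive. (`M` enters through `ℭ_{3/2}`'s `−4M²Λ/3`.)
[cite: Costa2019, Proposition 2.21] -/
def FermionicTSCoerciveThreeHalves (M a Λ s : ℝ) (ω : ℂ) (m : ℝ) (lam : ℂ) : Prop :=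
  s = 3 / 2 ∧ 0 ≤ (tsRadialConstantThreeHalves M a Λ ω m (lambdaBar a Λ (3 / 2) ω m lam)).re

/-- **CTdC Theorem 3.10, fermionic real-axis clause at `s = +3/2`, in the Teukolsky–Starobinsky-
coercive region — PROVED, packaged with CTdC's binder `Im λ̄ = 0`.** On subextremal Kerr–de Sitter:
`Im ω = 0`, `Im λ̄ = 0`, `FermionicTSCoerciveThreeHalves M a Λ s ω m λ` ⟹ every classical radial
Teukolsky solution on `(r₊, r_c)` ingoing at `𝓗⁺` and outgoing at `𝓗⁺_c` vanishes identically.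
[cite: CasalsTeixeiradacosta2022, Theorem 3.10 (second bullet, |s| = 3/2) with Costa2019
Proposition 2.21] -/
theorem radial_real_eq_zero_of_fermionicTSCoerciveThreeHalves {M a Λ s : ℝ} {ω : ℂ} {m : ℝ}
    {lam : ℂ} (hsub : IsSubextremal M a Λ) (hω : ω.im = 0)
    (hlamBar : (lambdaBar a Λ s ω m lam).im = 0)
    (hF : FermionicTSCoerciveThreeHalves M a Λ s ω m lam)
    {R : ℝ → ℂ} (hR : IsRadialTeukolskySolution M a Λ s ω m lam R)
    (hin : IsIngoingAtEventHorizon M a Λ s ω m R) (hout : IsOutgoingAtCosmoHorizon M a Λ ω m R) :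
    ∀ r ∈ Ioo (rPlus M a Λ) (rCosmo M a Λ), R r = 0 := by
  obtain ⟨rfl, hc⟩ := hF
  have hlam : lam.im = 0 := by rw [← im_lambdaBar_of_real a Λ (3 / 2) hω m lam]; exact hlamBar
  exact radial_threeHalves_real_eq_zero_of_coercive hsub hω hlam hc hR hin hout

end Literature.Geometry.Lorentzian.KerrDeSitter

end
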